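import Summits.SmoothPoincare4.SmoothPoincare4.Theorems.SullivanDualWitnessChargeReductionV16

/-!
# Route item `PencilLocalFamilyOfSphereFacts` (stmt-SmoothPoincare4-18037), closed

The glue item `Theses.SullivanDual.PencilLocalFamilyOfSphereFacts :
LocalFoliationEmbeddedSpheres → AdjunctionEmbeddedSpheres → PencilLocalFamily` is, up to unfolding the
two route items into the Literature named facts they transcribe verbatim, the landed
`helper_pencilLocalFamily_of_symplecticCapFacts` (crux `WitnessCharge`, line `Sketch`, reduction v16,
p154296: the one-chart end cap + HLS + adjunction).
-/

set_option linter.dupNamespace false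

namespace Summit.SmoothPoincare4.SmoothPoincare4.Theorems

/-- **Route item `PencilLocalFamilyOfSphereFacts` (stmt-SmoothPoincare4-18037).** -/
theorem pencilLocalFamilyOfSphereFacts_proof :
    Summit.SmoothPoincare4.SmoothPoincare4.Theses.SullivanDual.PencilLocalFamilyOfSphereFacts :=
  fun hL hA => WitnessCharge.PencilIncompleteness.helper_pencilLocalFamily_of_symplecticCapFacts hL hA

end Summit.SmoothPoincare4.SmoothPoincare4.Theorems
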